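import Summits.Ventures.PercRepro.ExploreTree
import Summits.Ventures.PercRepro.GZ24Final
import Summits.Ventures.PercRepro.ExploreChainA

/-!
# Exploration chains — the chains

Continuation of `ExploreChainA.lean` (split for the ≤ 400-line lint; proofs byte-identical): the section «Chains».
-/

namespace PercRepro

namespace MultiGraph

open Finset

variable {V E : Type*} [DecidableEq V] [DecidableEq E] {G : MultiGraph V E}

section Chains

variable [Fintype E] (G)

/-- Gladkov–Zimin's tree `S₁`: explore the cluster of `c` (to `S`), then the cluster of `a`
(to `Sᶜ`), then the cluster of `b` (to `S`). -/
noncomputable def chainS1 (a b c : V) : DTree E :=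
  G.exploreThen true Finset.univ {c} fun U₁ =>
    G.exploreThen false U₁ {a} fun U₂ =>
      G.exploreThen true U₂ {b} fun _ => DTree.leaf

variable {G}

/-- `S₁` continues the exploration tree of `c`. -/
theorem continues_chainS1 (a b c : V) : DTree.Continues (G.exploreTree c) (G.chainS1 a b c) := by
  unfold exploreTree chainS1
  rw [explore_eq_exploreThen]
  exact continues_exploreThen _ _ _ _

/-- `S₁` is proper. -/
theorem proper_chainS1 (a b c : V) : DTree.Proper (G.chainS1 a b c) ∅ := by
  unfold chainS1
  refine proper_exploreThen _ _ ?_ _ _ _ (fun _ _ h => h)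
  intro U₁ Q₁ h₁
  refine proper_exploreThen _ _ ?_ _ _ _ h₁
  intro U₂ Q₂ h₂
  exact proper_exploreThen _ (fun _ => DTree.leaf) (fun _ _ _ => trivial) _ _ _ h₂

/-- **The run of `S₁`** on a configuration with `a`, `b`, `c` in three different clusters is the
static set `swapSetC`: the edges at the cluster of `c`, plus the edges at the cluster of `b`
not at the cluster of `a`. -/
theorem run_chainS1 {ω : Config E} {a b c : V} (hab : ¬ G.Conn ω a b) (hac : ¬ G.Conn ω a c)
    (hbc : ¬ G.Conn ω b c) (ω' : Config E) :
    DTree.run (G.chainS1 a b c) ω ω' = G.swapSetC ω a b c := by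
  unfold chainS1
  rw [run_exploreThen, run_exploreThen, run_exploreThen]
  simp only [DTree.run, if_true, Bool.false_eq_true, if_false, Set.empty_union, Set.union_empty]
  -- the three stages
  set R₁ := G.exploreResult Finset.univ {c} ω with hR₁
  set R₂ := G.exploreResult R₁.1 {a} ω with hR₂
  set R₃ := G.exploreResult R₂.1 {b} ω with hR₃
  have hC : (↑R₁.2 : Set V) = G.cluster ω c := by
    rw [hR₁, coe_exploreResult_snd, onEdges_univ]
    ext x; simp [cluster]
  have hU₁ : R₁.1 = Finset.univ.filter fun e => G.fst e ∉ R₁.2 ∧ G.snd e ∉ R₁.2 :=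
    (exploreResult_spec (G := G) ω Finset.univ {c}).2.2.2
  have hA : (↑R₂.2 : Set V) = G.cluster ω a := by
    rw [hR₂, coe_exploreResult_snd, hU₁]
    have := cluster_onEdges_filter_eq (G := G) (ω := ω) (a := a) (U := Finset.univ) R₁.2
      (fun _ _ _ => Finset.mem_univ _) (fun x hx hxC => hac ?_)
    · ext x
      simp only [Set.mem_setOf_eq, Finset.mem_singleton, exists_eq_left]
      change x ∈ G.cluster _ a ↔ x ∈ G.cluster ω a
      rw [this]
    · have : x ∈ G.cluster ω c := by rw [← hC]; exact Finset.mem_coe.mpr hxC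
      exact (hx : G.Conn ω a x).trans (this : G.Conn ω c x).symm
  have hU₂ : R₂.1 = R₁.1.filter fun e => G.fst e ∉ R₂.2 ∧ G.snd e ∉ R₂.2 :=
    (exploreResult_spec (G := G) ω R₁.1 {a}).2.2.2
  have hB : (↑R₃.2 : Set V) = G.cluster ω b := by
    rw [hR₃, coe_exploreResult_snd, hU₂]
    have hUb : ∀ e, ω e = true → e ∈ G.edgesAt (G.cluster ω b) → e ∈ R₁.1 := by
      intro e he hmem
      rw [hU₁, Finset.mem_filter]
      refine ⟨Finset.mem_univ _, ?_⟩
      have hboth : G.fst e ∈ G.cluster ω b ∧ G.snd e ∈ G.cluster ω b := by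
        rcases hmem with h | h
        · exact ⟨h, G.snd_mem_cluster_of_open he h⟩
        · exact ⟨G.fst_mem_cluster_of_open he h, h⟩
      constructor
      · intro hf
        have : G.fst e ∈ G.cluster ω c := by rw [← hC]; exact Finset.mem_coe.mpr hf
        exact hbc ((hboth.1 : G.Conn ω b _).trans (this : G.Conn ω c _).symm)
      · intro hs
        have : G.snd e ∈ G.cluster ω c := by rw [← hC]; exact Finset.mem_coe.mpr hs
        exact hbc ((hboth.2 : G.Conn ω b _).trans (this : G.Conn ω c _).symm)
    have := cluster_onEdges_filter_eq (G := G) (ω := ω) (a := b) (U := R₁.1) R₂.2 hUb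
      (fun x hx hxA => hab ?_)
    · ext x
      simp only [Set.mem_setOf_eq, Finset.mem_singleton, exists_eq_left]
      change x ∈ G.cluster _ b ↔ x ∈ G.cluster ω b
      rw [this]
    · have : x ∈ G.cluster ω a := by rw [← hA]; exact Finset.mem_coe.mpr hxA
      exact (this : G.Conn ω a x).trans (hx : G.Conn ω b x).symm
  have hU₃ : R₃.1 = R₂.1.filter fun e => G.fst e ∉ R₃.2 ∧ G.snd e ∉ R₃.2 :=
    (exploreResult_spec (G := G) ω R₂.1 {b}).2.2.2
  -- assemble
  ext e
  have eC : ∀ x, x ∈ R₁.2 ↔ x ∈ G.cluster ω c := fun x => by rw [← hC]; rfl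
  have eA : ∀ x, x ∈ R₂.2 ↔ x ∈ G.cluster ω a := fun x => by rw [← hA]; rfl
  have eB : ∀ x, x ∈ R₃.2 ↔ x ∈ G.cluster ω b := fun x => by rw [← hB]; rfl
  simp only [Set.mem_union, Finset.coe_sdiff, Set.mem_sdiff, Finset.mem_coe, hU₃, hU₂, hU₁,
    Finset.mem_filter, Finset.mem_univ, true_and, eC, eA, eB, G.mem_swapSetC, mem_edgesAt]
  tauto

end Chains

end MultiGraph

end PercRepro
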